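import Literature.AnabelianGeometry.EtaleTheta.Discharge.Sec2InversionProofs

/-!
# [EtTh] Proposition 2.2 (ii), (iii): the derivable content, proved over `CoverDataAx`
# (proof-only companion)

Mochizuki, *The Étale Theta Function …* [EtTh], Publ. RIMS 45 (2009), §2, Prop 2.2 (ii), (iii),
PRIMS text pp.37–38 (locators `p.N` = PDF pages; bib key `MochizukiEtTh2009`).

PROOF-ONLY companion (no `def`, no new named fact) of `ThetaCovers.lean` / `ThetaCoversAxioms.lean`
(seat abc-iut-L2-t2), unit W2-L2-06 (abc-iut-L2-t10). The named facts `CoverData.Prop22_ii` /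
`CoverData.Prop22_iii` as first typed were bounced by review (p404132, 2026-08-25: conjunct (e) of
(ii) refutable; "`ι̲` of order `2`" must be read in `Δ̄_C̲`, i.e. `ι̲² ∈ Ker`). Pending the re-typed
statements we PROVE here, as stand-alone theorems over the (review-approved) predicates
`IsTypeLTorsPm`, `IsInversion`, `IsMinusEigen`, `IsSplitting`, the printed content that IS
derivable from the interface:

* `Dx_sup_eigen_eq` — (ii) "`D_x ≅ Π̄_X̲/Im(s_ι)`", surjectivity: `D_x · Im(s_ι) = Π_X̲`;
* `Dx_inf_eigen_le` — (ii) injectivity: `D_x ∩ Im(s_ι) ⊆ Ker(Δ_X ↠ Δ̄_X)`;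
* `splitting_sup_eigen_inf_deltaC` — (ii) "the geometric portion `Δ_X̲̲` of `Π_X̲̲ = S · Im(s_ι)`
  is `Im(s_ι)`": `(S · E) ∩ Δ_C = E`;
* `inversion_sq_mem_barTheta` — `ι̲² ∈ Δ̄_Θ`-preimage for every inversion `ι̲`;
* `exists_inversion_sq_mem_barKer` — (iii), first sentence, read in `Δ̄_C̲`: "there exists a unique
  coset `∈ Δ_C̲/Δ_X̲̲` such that `ι̲` has order `2` [in `Δ̄_C̲`] iff it belongs to this coset": an
  inversion `ι₀` with `ι₀² ∈ Ker` exists, and an inversion `ι₁` satisfies `ι₁² ∈ Ker` iff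
  `ι₀⁻¹ ι₁ ∈ E`.

Inputs: `l` odd, `Δ̄_X` of exponent `l`, `Δ̄_Θ` central, the inversion axioms of `CoverDataAx`
(`mem_barKer_of_sq_mem` from `Sec2InversionProofs`).
-/

namespace Literature.AnabelianGeometry.EtaleTheta

namespace ThetaCovers

namespace CoverDataAx

universe u

variable {l : ℕ} (X : CoverDataAx.{u} l)

/-! ## Proposition 2.2 (ii) -/

/-- **Prop 2.2 (ii), surjectivity of `D_x → Π̄_X̲/Im(s_ι)`**: `D_x · E = Π_X̲` (the cusp is
`K`-rational: `D_x ↠ G_K`, and `Δ_X̲ = E · Δ̄_Θ`-preimage with `Δ̄_Θ ⊆ I_x · Ker`).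
[cite: MochizukiEtTh2009, Prop 2.2(ii) p.37] -/
theorem Dx_sup_eigen_eq {H H' E : Subgroup X.PiC} {ι : X.PiC}
    (hH' : X.toCoverData.IsTypeLTorsPm H') (hH : H = H' ⊓ X.PiX)
    (hE : X.toCoverData.IsMinusEigen H H' ι E) : X.Dx ⊔ E = H := by
  haveI := X.barKer_normal
  have hT : X.toCoverData.IsTypeLTors H := by rw [hH]; exact hH'.inf_isTypeLTors
  have hEH : E ≤ H := hE.le.trans inf_le_left
  have hTle : X.barTheta ≤ X.Dx ⊔ E := by
    rw [← X.inertia_sup_barKer]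
    exact sup_le (inf_le_left.trans le_sup_left) (hE.barKer_le.trans le_sup_right)
  refine le_antisymm (sup_le hT.Dx_le hEH) fun h hh => ?_
  obtain ⟨⟨δ, hδ⟩, hδh⟩ := X.aug_Dx_surjective (X.aug h)
  have hδh : X.aug δ = X.aug h := hδh
  have hy : δ⁻¹ * h ∈ E ⊔ X.barTheta := by
    rw [hE.sup_eq]
    refine ⟨H.mul_mem (H.inv_mem (hT.Dx_le hδ)) hh, ?_⟩
    change δ⁻¹ * h ∈ X.aug.ker
    rw [MonoidHom.mem_ker, map_mul, map_inv, hδh, inv_mul_cancel]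
  have hy' : δ⁻¹ * h ∈ X.Dx ⊔ E := (sup_le le_sup_right hTle) hy
  have : h = δ * (δ⁻¹ * h) := by group
  rw [this]
  exact Subgroup.mul_mem _ (Subgroup.mem_sup_left hδ) hy'

/-- **Prop 2.2 (ii), injectivity of `D_x → Π̄_X̲/Im(s_ι)`** (modulo `Ker`): `D_x ∩ E ⊆ Ker`
(`I_x` maps into `Δ̄_Θ`, and `E ∩ Δ̄_Θ`-preimage `= Ker`). [cite: MochizukiEtTh2009, Prop 2.2(ii) p.37] -/
theorem Dx_inf_eigen_le {H H' E : Subgroup X.PiC} {ι : X.PiC}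
    (hE : X.toCoverData.IsMinusEigen H H' ι E) : X.Dx ⊓ E ≤ X.barKer := by
  rintro x ⟨hxD, hxE⟩
  have hxT : x ∈ X.barTheta := by
    rw [← X.inertia_sup_barKer]
    exact Subgroup.mem_sup_left ⟨hxD, (hE.le hxE).2⟩
  rw [← hE.inf_eq]
  exact ⟨hxE, hxT⟩

/-- **Prop 2.2 (ii), "the geometric portion `Δ_X̲̲` of `Π_X̲̲ := S · E` is `Im(s_ι) = E`"**:
`(S · E) ∩ Δ_C = E` for every splitting `S` of `D_x ↠ G_K`.
[cite: MochizukiEtTh2009, Prop 2.2(ii) p.37] -/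
theorem splitting_sup_eigen_inf_deltaC {H H' E S : Subgroup X.PiC} {ι : X.PiC}
    (hH' : X.toCoverData.IsTypeLTorsPm H') (hH : H = H' ⊓ X.PiX)
    (hE : X.toCoverData.IsMinusEigen H H' ι E) (hS : X.toCoverData.IsSplitting S) :
    (S ⊔ E) ⊓ X.DeltaC = E := by
  haveI := X.barTheta_normal
  haveI := X.barKer_normal
  have hT : X.toCoverData.IsTypeLTors H := by rw [hH]; exact hH'.inf_isTypeLTors
  have hSle : S ≤ H :=
    hS.le.trans (sup_le hT.Dx_le (X.barKer_le_barTheta.trans hT.barTheta_le))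
  have hEle : E ≤ H := hE.le.trans inf_le_left
  refine le_antisymm ?_ (le_inf le_sup_right (hE.le.trans inf_le_right))
  rintro x ⟨hxSE, hxC⟩
  haveI : (E.subgroupOf H).Normal :=
    (Subgroup.normal_subgroupOf_iff hEle).mpr fun e g he hg => hE.conj_mem g hg e he
  have hx' : (⟨x, sup_le hSle hEle hxSE⟩ : H) ∈ S.subgroupOf H ⊔ E.subgroupOf H := by
    rw [← Subgroup.subgroupOf_sup hSle hEle, Subgroup.mem_subgroupOf]; exact hxSE
  obtain ⟨y, hy, z, hz, hyz⟩ := Subgroup.mem_sup_of_normal_right.mp hx'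
  rw [Subgroup.mem_subgroupOf] at hy hz
  have hxyz : (y : X.PiC) * z = x := congrArg Subtype.val hyz
  have hzC : X.aug z = 1 := (hE.le hz).2
  have hyC : X.aug y = 1 := by
    have := congrArg X.aug hxyz
    rw [map_mul, hzC, mul_one] at this
    rw [this]; exact hxC
  obtain ⟨d, hd, k, hk, hdk⟩ := Subgroup.mem_sup_of_normal_right.mp (hS.le hy)
  have hdC : X.aug d = 1 := by
    have := congrArg X.aug hdk
    rw [map_mul, (X.barTheta_le (X.barKer_le_barTheta hk)).2, mul_one, hyC] at this
    exact this
  have hyT : (y : X.PiC) ∈ X.barTheta := by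
    rw [← X.inertia_sup_barKer, ← hdk]
    exact Subgroup.mul_mem _ (Subgroup.mem_sup_left ⟨hd, hdC⟩) (Subgroup.mem_sup_right hk)
  have hyK : (y : X.PiC) ∈ X.barKer := by rw [← hS.inf_eq]; exact ⟨hy, hyT⟩
  rw [← hxyz]
  exact E.mul_mem (hE.barKer_le hyK) hz

/-! ## Proposition 2.2 (iii): inversions of order `2` in `Δ̄_C̲` -/

/-- The square of an inversion lies in the `Δ̄_Θ`-preimage: `ι̲²` lies in `Δ_X̲ = E · Δ̄_Θ`-preimage,
is centralised by `ι̲`, and `ι̲` acts by `−1` on `E/Ker` (of odd exponent).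
[cite: MochizukiEtTh2009, Prop 2.2(iii) p.37] -/
theorem inversion_sq_mem_barTheta {H H' E : Subgroup X.PiC} {ι : X.PiC}
    (hH' : X.toCoverData.IsTypeLTorsPm H') (hH : H = H' ⊓ X.PiX)
    (hι : X.toCoverData.IsInversion H' ι) (hE : X.toCoverData.IsMinusEigen H H' ι E) :
    ι * ι ∈ X.barTheta := by
  haveI := X.barTheta_normal
  haveI := X.barKer_normal
  have hT : X.toCoverData.IsTypeLTors H := by rw [hH]; exact hH'.inf_isTypeLTors
  have hHX : H ≤ X.PiX := hT.le
  let π : X.PiC →* X.PiC ⧸ X.barKer := QuotientGroup.mk' X.barKer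
  have hπ : ∀ x, π x = 1 ↔ x ∈ X.barKer := fun x => QuotientGroup.eq_one_iff x
  -- `ι²` lies in `Δ_X̲ = E · Δ̄_Θ`-preimage
  have hι2 : ι * ι ∈ H ⊓ X.DeltaC := by
    refine ⟨?_, X.aug.ker.mul_mem hι.mem_delta hι.mem_delta⟩
    rw [hH]
    exact ⟨H'.mul_mem hι.mem hι.mem,
      (Subgroup.mul_mem_iff_of_index_two X.index_PiX).mpr Iff.rfl⟩
  rw [← hE.sup_eq] at hι2
  obtain ⟨e, he, t, ht, het⟩ := Subgroup.mem_sup_of_normal_right.mp hι2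
  -- `ι` acts by `−1` on `e` and `+1` on `t` modulo `Ker`, and trivially on `ι² = e t`
  have hπ4 : ∀ a b c d : X.PiC, a * b * c⁻¹ * d ∈ X.barKer ↔ π a * π b * (π c)⁻¹ * π d = 1 := by
    intro a b c d
    rw [← hπ, map_mul, map_mul, map_mul, map_inv]
  have hem : π ι * π e * (π ι)⁻¹ = (π e)⁻¹ := by
    rw [← mul_eq_one_iff_eq_inv, ← hπ4]
    exact hE.minus e he
  have htp : π ι * π t * (π ι)⁻¹ = π t := by
    have h := (hπ4 ι t ι t⁻¹).mp (hE.plus t ht)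
    rwa [map_inv, mul_inv_eq_one] at h
  have hfix : π ι * (π e * π t) * (π ι)⁻¹ = π e * π t := by
    rw [← map_mul, het, map_mul]
    group
  have he2 : π e * π e = 1 := by
    have h1 : π e * π t = (π e)⁻¹ * π t := by
      calc π e * π t = π ι * (π e * π t) * (π ι)⁻¹ := hfix.symm
        _ = (π ι * π e * (π ι)⁻¹) * (π ι * π t * (π ι)⁻¹) := by group
        _ = (π e)⁻¹ * π t := by rw [hem, htp]
    have h2 : π e = (π e)⁻¹ := mul_right_cancel h1
    calc π e * π e = (π e)⁻¹ * π e := by rw [← h2]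
      _ = 1 := inv_mul_cancel _
  have heK : e ∈ X.barKer := by
    refine X.mem_barKer_of_sq_mem ⟨hHX (hE.le he).1, (hE.le he).2⟩ ?_
    rw [← hπ, map_mul]; exact he2
  rw [← het]
  exact X.barTheta.mul_mem (X.barKer_le_barTheta heK) ht

/-- **Prop 2.2 (iii), first sentence, with "order `2`" read in `Δ̄_C̲`** (cf. the review of p404132):
there is an inversion `ι₀` with `ι₀² ∈ Ker(Δ_X ↠ Δ̄_X)`, and for every inversion `ι₁` one has
`ι₁² ∈ Ker ↔ ι₀⁻¹ ι₁ ∈ E` — "a unique coset `∈ Δ_C̲/Δ_X̲̲` such that `ι̲` has order `2` if and only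
if it belongs to this coset". [cite: MochizukiEtTh2009, Prop 2.2(iii) p.37] -/
theorem exists_inversion_sq_mem_barKer {H H' E : Subgroup X.PiC} {ι : X.PiC}
    (hH' : X.toCoverData.IsTypeLTorsPm H') (hH : H = H' ⊓ X.PiX)
    (hι : X.toCoverData.IsInversion H' ι) (hE : X.toCoverData.IsMinusEigen H H' ι E) :
    ∃ ι₀ : X.PiC, X.toCoverData.IsInversion H' ι₀ ∧ ι₀ * ι₀ ∈ X.barKer ∧
      ∀ ι₁ : X.PiC, X.toCoverData.IsInversion H' ι₁ → (ι₁ * ι₁ ∈ X.barKer ↔ ι₀⁻¹ * ι₁ ∈ E) := by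
  classical
  haveI := X.PiX_normal
  haveI := X.barTheta_normal
  haveI := X.barKer_normal
  have hT : X.toCoverData.IsTypeLTors H := by rw [hH]; exact hH'.inf_isTypeLTors
  obtain ⟨m, hm⟩ := X.l_odd
  have hHX : H ≤ X.PiX := hT.le
  have hTH : X.barTheta ≤ H := hT.barTheta_le
  have hTH' : X.barTheta ≤ H' := fun t ht => by
    have := hTH ht; rw [hH] at this; exact this.1
  have hTΔ : X.barTheta ≤ X.DeltaX := X.barTheta_le
  have hDΔ : ∀ {d}, d ∈ H ⊓ X.DeltaC → d ∈ X.DeltaX := fun hd => ⟨hHX hd.1, hd.2⟩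
  have hιC : ι ∈ X.aug.ker := hι.mem_delta
  have hιX : ι ∉ X.PiX := hι.not_mem
  let π : X.PiC →* X.PiC ⧸ X.barKer := QuotientGroup.mk' X.barKer
  have hπ : ∀ x, π x = 1 ↔ x ∈ X.barKer := fun x => QuotientGroup.eq_one_iff x
  have hπ4 : ∀ a b c d : X.PiC, a * b * c⁻¹ * d ∈ X.barKer ↔ π a * π b * (π c)⁻¹ * π d = 1 := by
    intro a b c d
    rw [← hπ, map_mul, map_mul, map_mul, map_inv]
  have hcomm4 : ∀ a b : X.PiC, a * b * a⁻¹ * b⁻¹ ∈ X.barKer → Commute (π a) (π b) := by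
    intro a b h
    have h1 : π a * π b * (π a)⁻¹ * π b⁻¹ = 1 := (hπ4 a b a b⁻¹).mp h
    rw [map_inv] at h1
    change π a * π b = π b * π a
    calc π a * π b = (π a * π b * (π a)⁻¹ * (π b)⁻¹) * (π b * π a) := by group
      _ = π b * π a := by rw [h1, one_mul]
  have hcen : ∀ t ∈ X.barTheta, ∀ x ∈ X.DeltaX, Commute (π t) (π x) :=
    fun t ht x hx => hcomm4 t x (X.barTheta_central t ht x hx)
  have hplus : ∀ t ∈ X.barTheta, Commute (π ι) (π t) :=
    fun t ht => hcomm4 ι t (X.inv_theta ι hιC hιX t ht)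
  have hminus : ∀ e ∈ E, π ι * π e * (π ι)⁻¹ = (π e)⁻¹ := by
    intro e he
    rw [← mul_eq_one_iff_eq_inv, ← hπ4]
    exact hE.minus e he
  -- the square of `ι`, and its square root in `Δ̄_Θ`
  have h2T : ι * ι ∈ X.barTheta := X.inversion_sq_mem_barTheta hH' hH hι hE
  set t₁ := (ι * ι) ^ m with ht₁_def
  have ht₁ : t₁ ∈ X.barTheta := X.barTheta.pow_mem h2T m
  -- `ι₀ := ι · (ι²)^m` satisfies `ι₀² = (ι²)^(2m+1) = (ι²)^l ∈ Ker`
  have h00 : ι * t₁ * (ι * t₁) ∈ X.barKer := by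
    rw [← hπ, map_mul, map_mul, ht₁_def, map_pow, map_mul]
    have hl : (π ι * π ι) ^ l = 1 := by
      rw [← map_mul, ← map_pow, hπ]; exact X.pow_mem_barKer _ (hTΔ h2T)
    have hc : Commute (π ι) ((π ι * π ι) ^ m) :=
      ((Commute.refl (π ι)).mul_right (Commute.refl (π ι))).pow_right m
    have h1 : π ι * (π ι * π ι) ^ m * (π ι * (π ι * π ι) ^ m) =
        (π ι * π ι) * ((π ι * π ι) ^ m * (π ι * π ι) ^ m) := by
      rw [mul_assoc (π ι) ((π ι * π ι) ^ m) (π ι * (π ι * π ι) ^ m),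
        ← mul_assoc ((π ι * π ι) ^ m) (π ι) ((π ι * π ι) ^ m), ← hc.eq,
        mul_assoc (π ι) ((π ι * π ι) ^ m) ((π ι * π ι) ^ m), ← mul_assoc]
    rw [h1, ← pow_add, ← pow_succ', show m + m + 1 = l by omega, hl]
  have hι₀X : ι * t₁ ∉ X.PiX := fun h =>
    hιX ((Subgroup.mul_mem_cancel_right X.PiX (hTΔ ht₁).1).mp h)
  refine ⟨ι * t₁, ⟨H'.mul_mem hι.mem (hTH' ht₁), X.aug.ker.mul_mem hιC (hTΔ ht₁).2, hι₀X⟩,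
    h00, fun ι₁ hι₁ => ?_⟩
  -- `x := ι₀⁻¹ ι₁ ∈ Δ_X̲ = E · Δ̄_Θ`-preimage
  have hx : (ι * t₁)⁻¹ * ι₁ ∈ H ⊓ X.DeltaC := by
    refine ⟨?_, X.aug.ker.mul_mem (X.aug.ker.inv_mem (X.aug.ker.mul_mem hιC (hTΔ ht₁).2))
      hι₁.mem_delta⟩
    rw [hH]
    refine ⟨H'.mul_mem (H'.inv_mem (H'.mul_mem hι.mem (hTH' ht₁))) hι₁.mem, ?_⟩
    have h0 : (ι * t₁)⁻¹ ∉ X.PiX := fun h => hι₀X (inv_mem_iff.mp h)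
    exact (Subgroup.mul_mem_iff_of_index_two X.index_PiX).mpr
      ⟨fun h => absurd h h0, fun h => absurd h hι₁.not_mem⟩
  have hx' : (ι * t₁)⁻¹ * ι₁ ∈ E ⊔ X.barTheta := by rw [hE.sup_eq]; exact hx
  obtain ⟨e, he, t, ht, het⟩ := Subgroup.mem_sup_of_normal_right.mp hx'
  have heΔ : e ∈ X.DeltaX := hDΔ (hE.le he)
  have hι₁eq : ι₁ = ι * t₁ * (e * t) := by rw [het]; group
  -- compute `ι₁²` modulo `Ker`: it is `t²`
  have hIA : Commute (π ι) (π t₁) := hplus t₁ ht₁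
  have hAB : Commute (π t₁) (π e) := hcen t₁ ht₁ e heΔ
  have hAC : Commute (π t₁) (π t) := hcen t₁ ht₁ t (hTΔ ht)
  have hBC : Commute (π e) (π t) := (hcen t ht e heΔ).symm
  have hIC : Commute (π ι) (π t) := hplus t ht
  have h00' : π ι * π t₁ * (π ι * π t₁) = 1 := by
    rw [← map_mul, ← map_mul, hπ]; exact h00
  have hIAB : π ι * π t₁ * π e * (π ι * π t₁)⁻¹ = (π e)⁻¹ := by
    calc π ι * π t₁ * π e * (π ι * π t₁)⁻¹ = π ι * (π t₁ * π e * (π t₁)⁻¹) * (π ι)⁻¹ := by group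
      _ = π ι * π e * (π ι)⁻¹ := by rw [hAB.eq, mul_inv_cancel_right]
      _ = (π e)⁻¹ := hminus e he
  have hIAC : π ι * π t₁ * π t * (π ι * π t₁)⁻¹ = π t := by
    calc π ι * π t₁ * π t * (π ι * π t₁)⁻¹ = π ι * (π t₁ * π t * (π t₁)⁻¹) * (π ι)⁻¹ := by group
      _ = π ι * π t * (π ι)⁻¹ := by rw [hAC.eq, mul_inv_cancel_right]
      _ = π t := by rw [hIC.eq, mul_inv_cancel_right]
  have key : π (ι₁ * ι₁) = π t * π t := by
    rw [hι₁eq]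
    simp only [map_mul]
    calc π ι * π t₁ * (π e * π t) * (π ι * π t₁ * (π e * π t))
        = (π ι * π t₁ * π e * (π ι * π t₁)⁻¹) * (π ι * π t₁ * π t * (π ι * π t₁)⁻¹) *
            (π ι * π t₁ * (π ι * π t₁)) * (π e * π t) := by group
      _ = (π e)⁻¹ * π t * 1 * (π e * π t) := by rw [hIAB, hIAC, h00']
      _ = (π e)⁻¹ * (π t * π e) * π t := by group
      _ = (π e)⁻¹ * (π e * π t) * π t := by rw [← hBC.eq]
      _ = π t * π t := by group
  have hι₁sq : ι₁ * ι₁ ∈ X.barKer ↔ t * t ∈ X.barKer := by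
    rw [← hπ, ← hπ, key, map_mul]
  constructor
  · intro h1
    have htK : t ∈ X.barKer := X.mem_barKer_of_sq_mem (hTΔ ht) (hι₁sq.mp h1)
    rw [← het]
    exact E.mul_mem he (hE.barKer_le htK)
  · intro h1
    rw [← het] at h1
    have htE : t ∈ E := by simpa using E.mul_mem (E.inv_mem he) h1
    have htK : t ∈ X.barKer := by rw [← hE.inf_eq]; exact ⟨htE, ht⟩
    exact hι₁sq.mpr (X.barKer.mul_mem htK htK)

end CoverDataAx

end ThetaCovers

end Literature.AnabelianGeometry.EtaleTheta
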